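import Summits.HubbardSuperconductivity.HubbardSuperconductivity.Theorems.BalabanIRBirComplexStableXYRCovarianceFRD
import Literature.Analysis.Matrix.FiniteRangeDecompositionPowGradient
import HarnessLib

/-!
# Crux `BirComplexStableXYR` (stmt-HubbardSuperconductivity-14845): MILESTONE M1, part 3 —
# the SMOOTH finite-range decomposition of the engine's real reference covariance, with
# volume-uniform gradient bounds

Support file (prover seat 1, route BalabanIR) for the restated engine
`…Theses.BalabanIR.BirComplexStableXYR`, line `log-concave-core-bounded-phase`, blueprint milestone M1
and the smoothness its milestone M2 consumes ("norms on polymer activities … contraction of the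
irrelevant vertex" need `∇^α C_j` bounds; the dipole lines between regrouped vertices carry
`∇∇C(x,y)`).  Parts 1–2 (`…CovarianceFRDMatrix.lean`, `…CovarianceFRD.lean`) decomposed the
covariance `(K·Q_c)⁻¹` of the Gaussian backbone into the dyadic Fejér SQUARE pieces
`frdPiece A N`, `A := (4/Λ_c)•H`, whose kernels are `O(2^{−N})` volume-uniformly but whose lattice
gradients are lossy.  Here the same Hessian matrix `H` of `Q_c` is decomposed into the POWER-`m`
pieces `C^{(m)}_N := frdPiecePow A m N` of `Literature/Analysis/Matrix/FiniteRangeDecompositionPow*.lean`: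

* `cfrd_scaled_facts` — the rescaled Hessian `A = (4/Λ_c)•H` is symmetric, translation invariant,
  `0 ≤ A ≤ 4`, and its symbol dominates `(4c₀/Λ_c)·ε` (`ε` the unit-step Laplacian symbol);
* `cfrd_frdPiecePow_gradient` — the volume-uniform gradient bound for the pieces of `A`;
* **`birHessian_covarianceFRD_gradient`** (registered stub of this seat on the crux item): for a table
  with (N) and (C) (`c₀ > 0`, `r ≥ 2`), every torus `(ℤ/L)²×ℤ/M`, every `m` and every scale `N` with
  `2^N ≤ L`, `2^N ≤ M`:
  - the EXACT identity `H · Σ_{N'<J} (4/Λ_c)•C^{(m)}_{N'} + R^{(m)}_J = 1` for every `J`;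
  - `C^{(m)}_N` is positive semidefinite and translation invariant (a covariance of a stationary
    Gaussian field on the space-time torus);
  - `C^{(m)}_N` has FINITE RANGE `≤ 2m·2^N·3(r−1)` in the torus `ℓ¹` metric;
  - the VOLUME-UNIFORM GRADIENT BOUNDS: for every list `l` of `k ≤ 2m − 2` unit steps `±E_i`,
    `|∇_{g₁}⋯∇_{g_k} C^{(m)}_N (x,y)| ≤ K(m,k,4c₀/Λ_c) · 2^{−N(k+1)}` for all `x, y`,
    `K(m,k,c) = (27m(2π)^k/4)(1 + 2^{k+4}π^{2m+2}/(16c)^{m+1})`, `Λ_c = 2·normA(c)·r³`.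
  Each lattice derivative gains one factor `2^{−N}` — the `d_eff = 3` single-shell scaling
  `L^{−(d−2+|α|)j}` of [Bauerschmidt2013, (1.10)] / [BrydgesGuadagniMitter2004, Thm. 1.1], for the
  engine's general (non-Markovian, merely coercive) finite-range form and every admissible table.
* `birHessian_covarianceFRD_dipole` — the corollary the blueprint's dipole estimate uses: with `m = 2`,
  mixed second differences `∇^x_{E_i}∇^y_{E_j} C^{(2)}_N(x,y)` (one difference in each variable) are
  `≤ K · 2^{−3N}` volume-uniformly.

No definitions; sorry-free. [folklore]
-/

noncomputable section

namespace Summit.HubbardSuperconductivity.HubbardSuperconductivity.Theorems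

set_option linter.dupNamespace false -- summit = problem name (single-conjunct summit), D-0017

open scoped BigOperators Matrix ComplexConjugate
open Complex Summit.HubbardSuperconductivity.BirComplexStableXYNegative
open Literature.Probability.LatticeModels Literature.Analysis.Matrix Literature.Analysis.Fourier

section CovarianceFRDGradient

variable {r : ℕ} {L M : ℕ} [NeZero L] [NeZero M]

-- The window linear form `a_{(s,n)}(j) = Σ_w n_w [sh s w = j]` (local abbreviation).
set_option quotPrecheck false in
local notation "aform[" L' "," M' "](" s "," n "," j ")" =>
  ∑ w, (((n w : ℤ) : ℝ) * (if sh L' M' s w = j then (1 : ℝ) else 0))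

-- The inline Hessian matrix of `Q_c` (local abbreviation).
set_option quotPrecheck false in
local notation "Hm[" c' "," L' "," M' "]" => (Matrix.of fun i j : Λ L' M' =>
  (-(∑ k : Λ L' M' × ↥((c' : Table _).support),
    (c' : Table _) k.2 * ((aform[L',M'](k.1, k.2.1, i) : ℝ) : ℂ)
      * ((aform[L',M'](k.1, k.2.1, j) : ℝ) : ℂ))).re)

-- the torus `ℓ¹` distance (local abbreviation; inline in statements)
set_option quotPrecheck false in
local notation "tdist[" L' "," M' "]" => (fun i j : Λ L' M' =>
  ((j.1 0 - i.1 0).valMinAbs.natAbs + (j.1 1 - i.1 1).valMinAbs.natAbs + (j.2 - i.2).valMinAbs.natAbs))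

-- the three unit steps of the space-time torus (local abbreviation; inline in statements)
set_option quotPrecheck false in
local notation "Evec[" L' "," M' "]" =>
  (![((![1, 0] : Literature.Probability.LatticeModels.TorusSite 2 L'), (0 : ZMod M')), (![0, 1], 0), (0, 1)]
    : Fin 3 → Λ L' M')

/-! ## The rescaled Hessian `A = (4/Λ_c)•H` -/

/-- `normA(c) > 0` version of the scale: `Λ_c = 2·normA(c)·r³ > 0` under (C), `c₀ > 0`, `r ≥ 2`. [folklore] -/
theorem cfrd_scale_pos (hr : 2 ≤ r) (c : Table r) {c₀ : ℝ} (hc₀ : 0 < c₀)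
    (hC : ∀ φ : W r → ℝ, c₀ * ∑ w, ∑ w', (1 - Real.cos (φ w - φ w')) ≤ (genF c φ).re) :
    0 < 2 * normA c * (r : ℝ) ^ 3 := by
  have hnA := cfrd_normA_pos hr c hc₀ hC
  have hr0 : (0 : ℝ) < r := by exact_mod_cast (show 0 < r by omega)
  positivity

/-- **The rescaled Hessian** `A = (4/Λ_c)•H` of `Q_c` is symmetric, translation invariant, `0 ≤ A ≤ 4`
(Loewner), and its symbol dominates the unit-step Laplacian symbol with constant `4c₀/Λ_c`. [folklore] -/
theorem cfrd_scaled_facts (hr : 2 ≤ r) (c : Table r) {c₀ : ℝ} (hc₀ : 0 < c₀)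
    (hN : c.sum (fun _ a => a) = 0)
    (hC : ∀ φ : W r → ℝ, c₀ * ∑ w, ∑ w', (1 - Real.cos (φ w - φ w')) ≤ (genF c φ).re) :
    ((4 / (2 * normA c * (r : ℝ) ^ 3)) • Hm[c,L,M]).IsHermitian
      ∧ IsTranslationInvariant ((4 / (2 * normA c * (r : ℝ) ^ 3)) • Hm[c,L,M])
      ∧ ((4 / (2 * normA c * (r : ℝ) ^ 3)) • Hm[c,L,M]).PosSemidef
      ∧ ((4 : ℝ) • (1 : Matrix (Λ L M) (Λ L M) ℝ) - (4 / (2 * normA c * (r : ℝ) ^ 3)) • Hm[c,L,M]).PosSemidef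
      ∧ ∀ ψ : AddChar (Λ L M) ℂ, 4 * c₀ / (2 * normA c * (r : ℝ) ^ 3) * ∑ i : Fin 3, (2 - 2 * (ψ (Evec[L,M] i)).re)
          ≤ (symbol ((4 / (2 * normA c * (r : ℝ) ^ 3)) • Hm[c,L,M]) ψ).re := by
  set H : Matrix (Λ L M) (Λ L M) ℝ := Hm[c,L,M] with hHdef
  set Λc : ℝ := 2 * normA c * (r : ℝ) ^ 3 with hΛc
  have hΛpos : 0 < Λc := cfrd_scale_pos hr c hc₀ hC
  have hHherm : H.IsHermitian := cfrd_isHermitian c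
  have hHti : IsTranslationInvariant H := cfrd_translationInvariant c
  have hHpsd : H.PosSemidef := cfrd_posSemidef hr c hc₀ hN hC
  have hHle : (Λc • (1 : Matrix (Λ L M) (Λ L M) ℝ) - H).PosSemidef := cfrd_le_smul_one c
  have h4Λ : 0 ≤ 4 / Λc := by positivity
  refine ⟨hHherm.smul (IsSelfAdjoint.all _), hHti.smul _, hHpsd.smul h4Λ, ?_, fun ψ => ?_⟩
  · have : (4 : ℝ) • (1 : Matrix (Λ L M) (Λ L M) ℝ) - (4 / Λc) • H
        = (4 / Λc) • (Λc • (1 : Matrix (Λ L M) (Λ L M) ℝ) - H) := by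
      rw [smul_sub, smul_smul, div_mul_cancel₀ _ hΛpos.ne']
    rw [this]
    exact hHle.smul h4Λ
  · have h := cfrd_symbol_ge hr c hc₀ hN hC ψ
    rw [symbol_smul, Complex.mul_re, Complex.ofReal_re, Complex.ofReal_im, zero_mul, sub_zero]
    calc 4 * c₀ / Λc * ∑ i : Fin 3, (2 - 2 * (ψ (Evec[L,M] i)).re)
        = 4 / Λc * (c₀ * ∑ i : Fin 3, (2 - 2 * (ψ (Evec[L,M] i)).re)) := by ring
      _ ≤ 4 / Λc * (symbol H ψ).re := mul_le_mul_of_nonneg_left h h4Λ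

/-! ## The power-`m` pieces of the covariance: finite range and gradient bounds -/

/-- **Finite range of the smooth covariance pieces**: every `frdPiecePow (t•H) m N` has range
`≤ 2m·2^N·3(r − 1)` in the torus `ℓ¹` metric, for every scalar `t`. [folklore] -/
theorem cfrd_hasFiniteRange_frdPiecePow (c : Table r) (t : ℝ) (m N : ℕ) :
    HasFiniteRange (tdist[L,M]) (2 * m * 2 ^ N * (3 * (r - 1))) (frdPiecePow (t • Hm[c,L,M]) m N) :=
  hasFiniteRange_frdPiecePow (fun i j k => cfrd_tdist_triangle i j k) (fun i => cfrd_tdist_self i)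
    ((cfrd_hasFiniteRange c).smul t) m N

/-- **Volume-uniform gradient bound for the smooth covariance pieces** (the analytic core of the
stub): for `l` a list of `k ≤ 2m − 2` unit steps `±E_i` and `2^N ≤ L, M`,
`|∇_l C^{(m)}_N(x,y)| ≤ K(m,k,4c₀/Λ_c)·2^{−N(k+1)}`. [folklore] -/
theorem cfrd_frdPiecePow_gradient (hr : 2 ≤ r) (c : Table r) {c₀ : ℝ} (hc₀ : 0 < c₀)
    (hN : c.sum (fun _ a => a) = 0)
    (hC : ∀ φ : W r → ℝ, c₀ * ∑ w, ∑ w', (1 - Real.cos (φ w - φ w')) ≤ (genF c φ).re)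
    (m N : ℕ) (hL : 2 ^ N ≤ L) (hM : 2 ^ N ≤ M)
    (l : List (Λ L M)) (hl : ∀ g ∈ l, ∃ i : Fin 3, g = Evec[L,M] i ∨ g = -(Evec[L,M] i))
    (hkm : l.length + 2 ≤ 2 * m) (x y : Λ L M) :
    |rowDiffs l (frdPiecePow ((4 / (2 * normA c * (r : ℝ) ^ 3)) • Hm[c,L,M]) m N) x y|
      ≤ 27 * m * (2 * Real.pi) ^ l.length / 4
          * (1 + 2 ^ (l.length + 4) * Real.pi ^ (2 * m + 2) / (16 * (4 * c₀ / (2 * normA c * (r : ℝ) ^ 3))) ^ (m + 1))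
          / ((2 : ℝ) ^ N) ^ (l.length + 1) := by
  obtain ⟨hAherm, hAti, hApsd, hA4, hcoer⟩ := cfrd_scaled_facts (L := L) (M := M) hr c hc₀ hN hC
  have hc₀' : 0 < 4 * c₀ / (2 * normA c * (r : ℝ) ^ 3) :=
    div_pos (by positivity) (cfrd_scale_pos hr c hc₀ hC)
  have hLN : ∀ i : Fin 3, 2 ^ N ≤ ((![L, L, M] : Fin 3 → ℕ) i) := by
    intro i; fin_cases i <;> simp [hL, hM]
  exact abs_rowDiffs_frdPiecePow_apply_le_inv_pow (Evec[L,M]) (![L, L, M])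
    (fun i => cfrd_order i) (fun ψ φ h => cfrd_addChar_ext ψ φ h) cfrd_card
    hAti hAherm hApsd hA4 hc₀' hcoer m N hLN l hl hkm x y

/-! ## The smooth finite-range decomposition of the covariance (registered stub) -/

/-- **MILESTONE M1, part 3 — the smooth finite-range decomposition of the engine's real reference
covariance with volume-uniform gradient bounds (registered stub `birHessian_covarianceFRD_gradient` of
prover seat 1 on crux 2R).**  See the module docstring for the reading of the five conjuncts. [folklore] -/
theorem birHessian_covarianceFRD_gradient : ∀ (r : ℕ) (c : Table r) (c₀ : ℝ), 2 ≤ r → 0 < c₀ → c.sum (fun _ a => a) = 0 → (∀ φ : W r → ℝ, c₀ * ∑ w, ∑ w', (1 - Real.cos (φ w - φ w')) ≤ (genF c φ).re) → ∀ (L M : ℕ) [NeZero L] [NeZero M] (m N : ℕ), 2 ^ N ≤ L → 2 ^ N ≤ M → (∀ J : ℕ, (Matrix.of fun i j : Λ L M => (-(∑ k : Λ L M × ↥c.support, c k.2 * ((∑ w, ((k.2 : Freq r) w : ℝ) * (if sh L M k.1 w = i then (1 : ℝ) else 0) : ℝ) : ℂ) * ((∑ w, ((k.2 : Freq r) w :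 ℝ) * (if sh L M k.1 w = j then (1 : ℝ) else 0) : ℝ) : ℂ))).re) * (∑ N' ∈ Finset.range J, (4 / (2 * normA c * (r : ℝ) ^ 3)) • Literature.Analysis.Matrix.frdPiecePow ((4 / (2 * normA c * (r : ℝ) ^ 3)) • (Matrix.of fun i j : Λ L M => (-(∑ k : Λ L M × ↥c.support, c k.2 * ((∑ w, ((k.2 : Freq r) w : ℝ) * (if sh L M k.1 w = i then (1 : ℝ) else 0) : ℝ) : ℂ) * ((∑ w, ((k.2 : Freq r) w : ℝ) * (if sh L M k.1 w = j then (1 : ℝ) else 0) : ℝ) : ℂ))).re)) m N') + Literature.Analysis.Matrix.frdRemainderPow ((4 / (2 * normA c * (r : ℝ) ^ 3)) • (Matrix.of fun i j : Λ L M => (-(∑ k : Λ L M × ↥c.support, c k.2 * ((∑ w, ((k.2 : Freq r) w : ℝ) * (if sh L M k.1 w = i then (1 : ℝ) else 0) : ℝ) : ℂ) * ((∑ w, ((k.2 : Freq r) w : ℝ) * (if sh L M k.1 w = j then (1 : ℝ) else 0) : ℝ) : ℂ))).re)) m J = 1) ∧ (Literature.Analysis.Matrix.frdPiecePow ((4 /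 (2 * normA c * (r : ℝ) ^ 3)) • (Matrix.of fun i j : Λ L M => (-(∑ k : Λ L M × ↥c.support, c k.2 * ((∑ w, ((k.2 : Freq r) w : ℝ) * (if sh L M k.1 w = i then (1 : ℝ) else 0) : ℝ) : ℂ) * ((∑ w, ((k.2 : Freq r) w : ℝ) * (if sh L M k.1 w = j then (1 : ℝ) else 0) : ℝ) : ℂ))).re)) m N).PosSemidef ∧ Literature.Analysis.Fourier.IsTranslationInvariant (Literature.Analysis.Matrix.frdPiecePow ((4 / (2 * normA c * (r : ℝ) ^ 3)) • (Matrix.of fun i j : Λ L M => (-(∑ k : Λ L M × ↥c.support, c k.2 * ((∑ w, ((k.2 : Freq r) w : ℝ) * (if sh L M k.1 w = i then (1 : ℝ) else 0) : ℝ) : ℂ) * ((∑ w, ((k.2 : Freq r) w : ℝ) * (if sh L M k.1 w = j then (1 : ℝ) else 0) : ℝ) : ℂ))).re)) m N) ∧ Literature.Analysis.Matrix.HasFiniteRange (fun i j : Λ L M => ((j.1 0 - i.1 0).valMinAbs.natAbs + (j.1 1 - i.1 1).valMinAbs.natAbs + (j.2 - i.2).valMinAbs.natAbs)) (2 * m *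 2 ^ N * (3 * (r - 1))) (Literature.Analysis.Matrix.frdPiecePow ((4 / (2 * normA c * (r : ℝ) ^ 3)) • (Matrix.of fun i j : Λ L M => (-(∑ k : Λ L M × ↥c.support, c k.2 * ((∑ w, ((k.2 : Freq r) w : ℝ) * (if sh L M k.1 w = i then (1 : ℝ) else 0) : ℝ) : ℂ) * ((∑ w, ((k.2 : Freq r) w : ℝ) * (if sh L M k.1 w = j then (1 : ℝ) else 0) : ℝ) : ℂ))).re)) m N) ∧ ∀ (l : List (Λ L M)), (∀ g ∈ l, ∃ i : Fin 3, g = (![((![1, 0] : Literature.Probability.LatticeModels.TorusSite 2 L), (0 : ZMod M)), (![0, 1], 0), (0, 1)] : Fin 3 → Λ L M) i ∨ g = -((![((![1, 0] : Literature.Probability.LatticeModels.TorusSite 2 L), (0 : ZMod M)), (![0, 1], 0), (0, 1)] : Fin 3 → Λ L M) i)) → l.length + 2 ≤ 2 * m → ∀ x y : Λ L M, |Literature.Analysis.Fourier.rowDiffs l (Literature.Analysis.Matrix.frdPiecePow ((4 / (2 * normA c * (r : ℝ) ^ 3)) • (Matrix.of fun i j : Λ L M => (-(∑ k : Λ L M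 × ↥c.support, c k.2 * ((∑ w, ((k.2 : Freq r) w : ℝ) * (if sh L M k.1 w = i then (1 : ℝ) else 0) : ℝ) : ℂ) * ((∑ w, ((k.2 : Freq r) w : ℝ) * (if sh L M k.1 w = j then (1 : ℝ) else 0) : ℝ) : ℂ))).re)) m N) x y| ≤ 27 * m * (2 * Real.pi) ^ l.length / 4 * (1 + 2 ^ (l.length + 4) * Real.pi ^ (2 * m + 2) / (16 * (4 * c₀ / (2 * normA c * (r : ℝ) ^ 3))) ^ (m + 1)) / ((2 : ℝ) ^ N) ^ (l.length + 1) := by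
  intro r c c₀ hr hc₀ hN hC L M _ _ m N hL hM
  obtain ⟨hAherm, hAti, hApsd, hA4, -⟩ := cfrd_scaled_facts (L := L) (M := M) hr c hc₀ hN hC
  refine ⟨fun J => ?_, posSemidef_frdPiecePow hAherm hA4 m N, isTranslationInvariant_frdPiecePow hAti m N,
    cfrd_hasFiniteRange_frdPiecePow c _ m N,
    fun l hl hkm x y => cfrd_frdPiecePow_gradient hr c hc₀ hN hC m N hL hM l hl hkm x y⟩
  -- the exact identity, from `frdPow_identity` for `A = (4/Λc)•H`
  have hid := frdPow_identity ((4 / (2 * normA c * (r : ℝ) ^ 3)) • Hm[c,L,M]) m J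
  rw [← Finset.smul_sum, mul_smul_comm, ← smul_mul_assoc]
  exact hid

/-- **The dipole bound** (corollary for the blueprint's single- or multi-scale cluster expansion): with
`m = 2`, the mixed second difference of the smooth piece — one forward difference in EACH variable,
`∇^x_{E_i}∇^y_{E_j} C(x,y) = C(x+E_i,y+E_j) − C(x,y+E_j) − C(x+E_i,y) + C(x,y)` — is
`≤ K(2,2,4c₀/Λ_c)·2^{−3N}` volume-uniformly (`2^N ≤ L, M`): the lattice `|x−y|⁻³` dipole kernel,
scale by scale. [folklore] -/
theorem birHessian_covarianceFRD_dipole (hr : 2 ≤ r) (c : Table r) {c₀ : ℝ} (hc₀ : 0 < c₀)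
    (hN : c.sum (fun _ a => a) = 0)
    (hC : ∀ φ : W r → ℝ, c₀ * ∑ w, ∑ w', (1 - Real.cos (φ w - φ w')) ≤ (genF c φ).re)
    (N : ℕ) (hL : 2 ^ N ≤ L) (hM : 2 ^ N ≤ M) (i j : Fin 3) (x y : Λ L M) :
    |frdPiecePow ((4 / (2 * normA c * (r : ℝ) ^ 3)) • Hm[c,L,M]) 2 N (x + Evec[L,M] i) (y + Evec[L,M] j)
        - frdPiecePow ((4 / (2 * normA c * (r : ℝ) ^ 3)) • Hm[c,L,M]) 2 N x (y + Evec[L,M] j)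
        - frdPiecePow ((4 / (2 * normA c * (r : ℝ) ^ 3)) • Hm[c,L,M]) 2 N (x + Evec[L,M] i) y
        + frdPiecePow ((4 / (2 * normA c * (r : ℝ) ^ 3)) • Hm[c,L,M]) 2 N x y|
      ≤ 27 * 2 * (2 * Real.pi) ^ 2 / 4
          * (1 + 2 ^ 6 * Real.pi ^ 6 / (16 * (4 * c₀ / (2 * normA c * (r : ℝ) ^ 3))) ^ 3)
          / ((2 : ℝ) ^ N) ^ 3 := by
  have hti : IsTranslationInvariant (frdPiecePow ((4 / (2 * normA c * (r : ℝ) ^ 3)) • Hm[c,L,M]) 2 N) :=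
    isTranslationInvariant_frdPiecePow ((cfrd_translationInvariant c).smul _) 2 N
  have hl : ∀ g ∈ [Evec[L,M] i, -(Evec[L,M] j)], ∃ i' : Fin 3, g = Evec[L,M] i' ∨ g = -(Evec[L,M] i') := by
    intro g hg
    simp only [List.mem_cons, List.not_mem_nil, or_false] at hg
    rcases hg with rfl | rfl
    · exact ⟨i, Or.inl rfl⟩
    · exact ⟨j, Or.inr rfl⟩
  have h := cfrd_frdPiecePow_gradient hr c hc₀ hN hC 2 N hL hM [Evec[L,M] i, -(Evec[L,M] j)] hl
    (by simp) x y
  rw [hti.mixedDiff_eq_rowDiffs]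
  refine h.trans (le_of_eq ?_)
  simp only [List.length_cons, List.length_nil]
  norm_num

end CovarianceFRDGradient

end Summit.HubbardSuperconductivity.HubbardSuperconductivity.Theorems

end
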